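import Mathlib
import Literature.Computability.AlgebraicComplexity.LandsbergRessayreNormalForm
import Summits.ValiantsHypothesis.ValiantsHypothesis.Theses.RefutationDegree

/-!
# The adjugate dictionary in the normal form `Λ_{i₀}` (line `Sketch`, crux `BeyondHessianNs`)

Helper file for crux item stmt-ValiantsHypothesis-5641 (`RefutationDegree.BeyondHessianNs`),
stub `stub_adjugate_row_col` of the registered skeleton.

Pure matrix algebra over a field.  If `V M U = Λ_{i₀}` (`Λ_{i₀}` the diagonal matrix with `0` at
`i₀` and `1` elsewhere) with `V, U` invertible, then

* `adj Λ_{i₀} = E_{i₀ i₀}` (`adjugate_lamMatrix`), hence `adj U · adj M · adj V = E_{i₀ i₀}` and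
  `(det U · det V) • adj M = U E_{i₀ i₀} V`; in particular `adj M ≠ 0`;
* `adj M · A₀ ≠ 0` forces a non-zero entry in the row `i₀` of `V A₀ U`, and `A₀ · adj M ≠ 0`
  forces a non-zero entry in the column `i₀` of `V A₀ U` (`stub_adjugate_row_col`): with
  `N := V A₀ U`, `(det U det V) • (adj M · A₀) = U (E_{i₀ i₀} N) U⁻¹` and
  `(det U det V) • (A₀ · adj M) = V⁻¹ (N E_{i₀ i₀}) V`.
-/

noncomputable section

-- `Summit.ValiantsHypothesis.ValiantsHypothesis.…` is the tree's mandated single-conjunct layout.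
set_option linter.dupNamespace false

namespace Summit.ValiantsHypothesis.ValiantsHypothesis.Theorems.RefutationDegreeBeyondHessianNs

open Matrix
open Literature.Computability.AlgebraicComplexity

/-- The adjugate of the normal form `Λ_{i₀} = diag(…, 1, 0, 1, …)` is the elementary matrix
`E_{i₀ i₀} = diag(Pi.single i₀ 1)`: the cofactor at `(i₀, i₀)` is a product of ones, every other
diagonal cofactor contains the factor `0` at `i₀`. [folklore] -/
theorem adjugate_lamMatrix {K : Type*} [Field K] {o : Type*} [Fintype o] [DecidableEq o]
    (i₀ : o) : (lamMatrix K i₀).adjugate = Matrix.diagonal (Pi.single i₀ (1 : K)) := by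
  unfold lamMatrix
  rw [Matrix.adjugate_diagonal]
  congr 1
  funext i
  by_cases hi : i = i₀
  · subst hi
    rw [Pi.single_eq_same]
    exact Finset.prod_eq_one fun j hj => by simp [Finset.ne_of_mem_erase hj]
  · rw [Pi.single_eq_of_ne hi]
    exact Finset.prod_eq_zero (Finset.mem_erase.mpr ⟨Ne.symm hi, Finset.mem_univ _⟩) (by simp)

/-- **The adjugate dictionary in the normal form**: if `V M U = Λ_{i₀}` with `V, U` invertible,
then `adj M ≠ 0` (`adj U · adj M · adj V = adj Λ_{i₀} = E_{i₀i₀}`), and `adj M · A₀ ≠ 0`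
(resp. `A₀ · adj M ≠ 0`) forces a non-zero entry in the row (resp. column) `i₀` of `V A₀ U`.
[folklore] -/
theorem stub_adjugate_row_col {K : Type*} [Field K] {o : Type*} [Fintype o] [DecidableEq o]
    (M A₀ V U : Matrix o o K) (i₀ : o) (hV : IsUnit V) (hU : IsUnit U)
    (hVMU : V * M * U = lamMatrix K i₀) :
    M.adjugate ≠ 0 ∧
    (M.adjugate * A₀ ≠ 0 → ∃ s, (V * A₀ * U) i₀ s ≠ 0) ∧
    (A₀ * M.adjugate ≠ 0 → ∃ s, (V * A₀ * U) s i₀ ≠ 0) := by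
  have hVd : IsUnit V.det := (Matrix.isUnit_iff_isUnit_det V).mp hV
  have hUd : IsUnit U.det := (Matrix.isUnit_iff_isUnit_det U).mp hU
  have hc : U.det * V.det ≠ 0 := mul_ne_zero hUd.ne_zero hVd.ne_zero
  -- `adj U · adj M · adj V = E_{i₀ i₀}`
  have hadj : U.adjugate * M.adjugate * V.adjugate = Matrix.diagonal (Pi.single i₀ (1 : K)) := by
    rw [← adjugate_lamMatrix i₀, ← hVMU, Matrix.adjugate_mul_distrib, Matrix.adjugate_mul_distrib,
      Matrix.mul_assoc]
  -- `(det U · det V) • adj M = U · E_{i₀ i₀} · V`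
  have hkey : (U.det * V.det) • M.adjugate = U * Matrix.diagonal (Pi.single i₀ (1 : K)) * V := by
    calc (U.det * V.det) • M.adjugate
        = (U * U.adjugate) * M.adjugate * (V.adjugate * V) := by
          rw [Matrix.mul_adjugate, Matrix.adjugate_mul, Matrix.smul_mul, Matrix.one_mul,
            Matrix.mul_smul, Matrix.mul_one, smul_smul, mul_comm V.det U.det]
      _ = U * (U.adjugate * M.adjugate * V.adjugate) * V := by simp only [Matrix.mul_assoc]
      _ = U * Matrix.diagonal (Pi.single i₀ (1 : K)) * V := by rw [hadj]
  refine ⟨fun h0 => ?_, fun h => ?_, fun h => ?_⟩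
  · -- `adj M = 0` would give `E_{i₀ i₀} = 0`
    have h1 : Matrix.diagonal (Pi.single i₀ (1 : K)) i₀ i₀ = 0 := by
      rw [← hadj, h0, Matrix.mul_zero, Matrix.zero_mul, Matrix.zero_apply]
    simp at h1
  · -- row `i₀` of `N = V A₀ U` zero ⟹ `E_{i₀ i₀} N = 0` ⟹ `adj M · A₀ = 0`
    by_contra hrow
    push Not at hrow
    apply h
    have hDN : Matrix.diagonal (Pi.single i₀ (1 : K)) * (V * A₀ * U) = 0 := by
      ext i j
      rw [Matrix.diagonal_mul, Matrix.zero_apply]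
      by_cases hi : i = i₀
      · rw [hi, hrow j, mul_zero]
      · rw [Pi.single_eq_of_ne hi, zero_mul]
    have h2 : (U.det * V.det) • (M.adjugate * A₀) = 0 := by
      rw [← Matrix.smul_mul, hkey, ← Matrix.mul_nonsing_inv_cancel_right U
        (U * Matrix.diagonal (Pi.single i₀ (1 : K)) * V * A₀) hUd]
      have h3 : U * Matrix.diagonal (Pi.single i₀ (1 : K)) * V * A₀ * U =
          U * (Matrix.diagonal (Pi.single i₀ (1 : K)) * (V * A₀ * U)) := by
        simp only [Matrix.mul_assoc]
      rw [h3, hDN, Matrix.mul_zero, Matrix.zero_mul]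
    exact (smul_eq_zero.mp h2).resolve_left hc
  · -- column `i₀` of `N = V A₀ U` zero ⟹ `N E_{i₀ i₀} = 0` ⟹ `A₀ · adj M = 0`
    by_contra hcol
    push Not at hcol
    apply h
    have hND : V * A₀ * U * Matrix.diagonal (Pi.single i₀ (1 : K)) = 0 := by
      ext i j
      rw [Matrix.mul_diagonal, Matrix.zero_apply]
      by_cases hj : j = i₀
      · rw [hj, hcol i, zero_mul]
      · rw [Pi.single_eq_of_ne hj, mul_zero]
    have h2 : (U.det * V.det) • (A₀ * M.adjugate) = 0 := by
      rw [← Matrix.mul_smul, hkey, ← Matrix.nonsing_inv_mul_cancel_left V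
        (A₀ * (U * Matrix.diagonal (Pi.single i₀ (1 : K)) * V)) hVd]
      have h3 : V * (A₀ * (U * Matrix.diagonal (Pi.single i₀ (1 : K)) * V)) =
          V * A₀ * U * Matrix.diagonal (Pi.single i₀ (1 : K)) * V := by
        simp only [Matrix.mul_assoc]
      rw [h3, hND, Matrix.zero_mul, Matrix.mul_zero]
    exact (smul_eq_zero.mp h2).resolve_left hc

end Summit.ValiantsHypothesis.ValiantsHypothesis.Theorems.RefutationDegreeBeyondHessianNs
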